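import Summits.Parity.GeneralizedHardyLittlewood.Theorems.LZZCertificateReplayLightRows
import Summits.Parity.GeneralizedHardyLittlewood.Theorems.LZZCertificateReplayHeavyRows
import Literature.NumberTheory.LFunctions.NoRealZeroCertificateReplayUpTo
import Literature.NumberTheory.LFunctions.RealCharacterLadderLeaves

/-!
# Route `LZZCertificateReplay` — the rung leaf `NoExceptionalZeroUpTo_4e5_fifth`, UNCONDITIONAL

The route's residual `Theorem21` (Lu–Zaman–Zhao, Math. Comp. 2026, Theorem 2.1 AS PRINTED; named fact
`LuZamanZhao2026.theorem21`, item stmt-Parity-19787) is no longer load-bearing: the decision rule of the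
kernel replay only ever uses Theorem 2.1 at moduli `q ≤ 4·10⁵` and real zeros `β₁ ∈ (½, 1)`, and that
restriction — `LuZamanZhao2026.theorem21UpTo 400000` — is PROVED in the tree
(`theorem21UpTo_fourHundredThousand`, file `RealZeroVonMangoldtSeriesBoundUpTo.lean`) from the classical
GLOBAL partial-fraction inequality WITH the partner zero `1 − β₁` (`RealZeroGlobalLogDerivBound.lean`:
genus-zero Hadamard product of `Ξ_χ = ξ(·,χ)ξ(·,χ̄)`, de la Vallée Poussin's bound for `−ζ'/ζ(σ)`) and eight
kernel interval evaluations of `ψ`, `log`, `π` (thinnest gap `0.0208` at `λ = 1.6`, odd `χ`, `q = 4·10⁵`).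

* `globalThresholdBound_holds` — `G := LuZamanZhao2026.theorem21UpTo 400000` holds (the decl a re-glued
  route item `GlobalThresholdBound := G` is closed by);
* `noExceptionalZeroUpTo_4e5_fifth_of_lightRows_heavyRows_globalBound` — `LightRows → HeavyRows → G → leaf`
  (the re-glue's deciding composition, via `Replay.noExceptionalZeroUpTo_of_light_heavy_upTo`);
* **`noExceptionalZeroUpTo_4e5_fifth : NoExceptionalZeroUpTo_4e5_fifth`** — for every modulus
  `3 ≤ q ≤ 4·10⁵`, every primitive quadratic `χ` mod `q` and every real `σ ∈ (0, 1]` with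
  `σ ≥ 1 − 1/(5 log q)`, `L(σ, χ) ≠ 0`. UNCONDITIONAL: standard axioms only; trust base = the Lean kernel
  (243 107 replayed Table-1 certificates, `lightRows_holds` p433991…/`heavyRows_holds` p445005, the base
  tables `q ≤ 52` / odd `q ≤ 163`, and the analytic inequality above). Previously this range rested on
  Platt's numerical verification (named facts) or on `theorem21`.

WHAT THIS IS NOT: not a proof of Theorem 2.1 as printed (`theorem21` stays a typed named fact; for
`q ≳ 4.3·10⁵` the classical inequality is weaker than the printed one); nothing beyond `4·10⁵`; no Parity
credit (cell rule H5) — an instrument leaf with kernel currency.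
-/

namespace Summit.Parity.GeneralizedHardyLittlewood.Theorems

open Summit.Parity.GeneralizedHardyLittlewood.Theses
open Literature.NumberTheory.LFunctions

/-- **`G` holds**: Lu–Zaman–Zhao's Theorem 2.1 restricted to moduli `3 ≤ q ≤ 4·10⁵` and real zeros
`β₁ ∈ (½, 1)` (`LuZamanZhao2026.theorem21UpTo 400000`) — PROVED (`theorem21UpTo_fourHundredThousand`). -/
theorem globalThresholdBound_holds : LuZamanZhao2026.theorem21UpTo 400000 :=
  LuZamanZhao2026.theorem21UpTo_fourHundredThousand

/-- **The re-glued composition**: `LightRows → HeavyRows → G → NoExceptionalZeroUpTo_4e5_fifth`, by the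
LIGHT/HEAVY glue on the restricted hypothesis (`Replay.noExceptionalZeroUpTo_of_light_heavy_upTo`). -/
theorem noExceptionalZeroUpTo_4e5_fifth_of_lightRows_heavyRows_globalBound
    (hl : LZZCertificateReplay.LightRows) (hh : LZZCertificateReplay.HeavyRows)
    (hG : LuZamanZhao2026.theorem21UpTo 400000) : NoExceptionalZeroUpTo_4e5_fifth := by
  show NoExceptionalZeroUpTo 400000 (1 / 5)
  exact LuZamanZhao2026.Replay.noExceptionalZeroUpTo_of_light_heavy_upTo hG hl hh

/-- `Theorem21 → G`: the printed residual implies the restricted statement (so the re-glue weakens the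
route's hypothesis). -/
theorem globalThresholdBound_of_theorem21 (h21 : LZZCertificateReplay.Theorem21) :
    LuZamanZhao2026.theorem21UpTo 400000 :=
  LuZamanZhao2026.theorem21UpTo_of_theorem21 h21 400000

/-- **The rung leaf, UNCONDITIONAL: `NoExceptionalZeroUpTo_4e5_fifth`** (`= NoExceptionalZeroUpTo 400000 (1/5)`):
for every modulus `3 ≤ q ≤ 4·10⁵`, every primitive quadratic character `χ` mod `q` and every real
`σ ∈ (0, 1]` with `σ ≥ 1 − 1/(5 log q)`, `L(σ, χ) ≠ 0`. From `lightRows_holds`, `heavyRows_holds` (the kernel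
replay of the Table-1 certificates below `4·10⁵`) and `globalThresholdBound_holds`. Standard axioms. -/
theorem noExceptionalZeroUpTo_4e5_fifth : NoExceptionalZeroUpTo_4e5_fifth :=
  noExceptionalZeroUpTo_4e5_fifth_of_lightRows_heavyRows_globalBound lightRows_holds heavyRows_holds
    globalThresholdBound_holds

end Summit.Parity.GeneralizedHardyLittlewood.Theorems
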